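import Literature.AlgebraicTopology.SingularHomology.LerayHirschTelescope
import Literature.Topology.DisjointCountableRefinement
import HarnessLib

/-!
# The Leray–Hirsch theorem over a paracompact base (from local to global)

D. Husemoller, *Fibre Bundles* (3rd ed. 1994), Ch. 17 §1 Thm. 1.1 (Leray–Hirsch) with Rem. 1.2,
and J. Milnor, J. Stasheff, *Characteristic Classes* (1974), §5 proof of Lemma 5.9 / §10 proof of
Thm. 10.4 (the passage from trivialising open sets to an ARBITRARY paracompact base: a countable
cover `B = ⋃ₖ W_k` in which each `W_k` is a disjoint union of open sets each inside a member of the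
given cover, then the increasing exhaustion `W_0 ∪ ⋯ ∪ W_n`). A. Hatcher, *Algebraic Topology*
(2002), Thm. 4D.1.

**`LerayHirsch.bijective_of_cover`**: let `p : E → B` be a map to a paracompact Hausdorff space,
`cⱼ ∈ Hᵈʲ(E; R)` finitely many classes, and `(U_α)` an open cover of `B` such that the comparison
map `θ_W : Π_{d j ≤ k} Hᵏ⁻ᵈʲ(W) → Hᵏ(p⁻¹W)`, `(aⱼ) ↦ Σ p^*aⱼ ⌣ cⱼ|`, is bijective (all `k`) for
EVERY open `W` contained in some `U_α` ("hereditarily"; for bundles: every open subset of a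
trivialising set is trivialising). Then `θ : Π_{d j ≤ k} Hᵏ⁻ᵈʲ(B) → Hᵏ(E)` is bijective, i.e.
`H*(E; R)` is a free `H*(B; R)`-module on the `cⱼ` in the graded sense.

Proof: Milnor's countable cover by disjoint unions (`Literature/Topology/DisjointCountableRefinement`),
the disjoint-union and union steps (`LerayHirschUnion`, applied hereditarily:
`isLH_inter_level`, `isLH_inter_exhaustion`) and the telescope (`LerayHirschTelescope`).
Everything is proved; no named facts.

## References

* D. Husemoller, *Fibre Bundles*, GTM 20, Springer 1994, Ch. 17 §1 Thm. 1.1, Rem. 1.2. [HusemollerFibreBundles1994]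
* J. Milnor, J. Stasheff, *Characteristic Classes*, PUP 1974, §5 Lemma 5.9 (proof), §10 Thm. 10.4 (proof). [MilnorStasheff1974]
* A. Hatcher, *Algebraic Topology*, CUP 2002, §4.D Thm. 4D.1. [HatcherAT2002]
-/

noncomputable section

open CategoryTheory Function Set Literature.Topology

universe u w

namespace Literature.AlgebraicTopology.SingularHomology

namespace LerayHirsch

variable (R : Type u) [CommRing R] {ι : Type w} [Fintype ι] (d : ι → ℕ)
variable {X B : Type u} [TopologicalSpace X] [TopologicalSpace B] (p : C(X, B)) (c : (j : ι) → singularCohomology R R X (d j))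

section Cover

variable {α : Type*} {U : α → Set B} (hloc : ∀ (a : α) (W : Set B), IsOpen W → W ⊆ U a → IsLH R d p c W)
  {W : Finset α → Set B} (hWo : ∀ S, IsOpen (W S)) (hWU : ∀ S : Finset α, S.Nonempty → ∃ a, W S ⊆ U a)
  (hdisj : ∀ k : ℕ, ({S : Finset α | S.card = k + 1}).PairwiseDisjoint W)

/-- The `k`-th level `W_k = ⋃_{|S| = k+1} W(S)` of a Milnor cover. [cite: MilnorStasheff1974, §5 Lemma 5.9 (proof)] -/
def level (W : Finset α → Set B) (k : ℕ) : Set B := ⋃ S : {S : Finset α // S.card = k + 1}, W S.1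

/-- The exhaustion `W_0 ∪ ⋯ ∪ W_n`. [cite: MilnorStasheff1974, §10 Thm. 10.4 (proof)] -/
def exhaustion (W : Finset α → Set B) : ℕ → Set B
  | 0 => level W 0
  | n + 1 => exhaustion W n ∪ level W (n + 1)

include hWo in
/-- The levels are open. [folklore] -/
theorem isOpen_level (k : ℕ) : IsOpen (level W k) := isOpen_iUnion fun S ↦ hWo S.1

include hWo in
/-- The exhaustion is open. [folklore] -/
theorem isOpen_exhaustion : ∀ n, IsOpen (exhaustion W n)
  | 0 => isOpen_level hWo 0
  | n + 1 => (isOpen_exhaustion n).union (isOpen_level hWo (n + 1))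

omit [TopologicalSpace B] in
/-- The exhaustion is increasing. [folklore] -/
theorem monotone_exhaustion : Monotone (exhaustion W) :=
  monotone_nat_of_le_succ fun _ ↦ subset_union_left

omit [TopologicalSpace B] in
/-- `W_n ⊆ W_0 ∪ ⋯ ∪ W_n`. [folklore] -/
theorem level_subset_exhaustion : ∀ n, level W n ⊆ exhaustion W n
  | 0 => Subset.rfl
  | _ + 1 => subset_union_right

omit [TopologicalSpace B] in
/-- If the `W(S)` cover, the exhaustion exhausts. [folklore] -/
theorem iUnion_exhaustion (hcov : (⋃ k : ℕ, ⋃ S ∈ {S : Finset α | S.card = k + 1}, W S) = univ) :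
    ⋃ n, exhaustion W n = univ := by
  refine eq_univ_of_forall fun b ↦ ?_
  have hb : b ∈ ⋃ k : ℕ, ⋃ S ∈ {S : Finset α | S.card = k + 1}, W S := by rw [hcov]; exact mem_univ b
  obtain ⟨k, hk⟩ := mem_iUnion.1 hb
  obtain ⟨S, hS, hbS⟩ := mem_iUnion₂.1 hk
  exact mem_iUnion.2 ⟨k, level_subset_exhaustion k (mem_iUnion.2 ⟨⟨S, hS⟩, hbS⟩)⟩

include hloc hWo hWU hdisj in
/-- **`θ` is bijective over `V ∩ W_k` for every open `V`** (a disjoint union of open subsets of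
members of the cover). [cite: MilnorStasheff1974, §10 Thm. 10.4 (proof)] -/
theorem isLH_inter_level {V : Set B} (hV : IsOpen V) (k : ℕ) : IsLH R d p c (V ∩ level W k) := by
  rw [level, inter_iUnion]
  refine isLH_iUnion_of_pairwise_disjoint R d p c (fun S ↦ hV.inter (hWo S.1)) (fun S T hST ↦ ?_) fun S ↦ ?_
  · exact (hdisj k S.2 T.2 (fun h ↦ hST (Subtype.ext h))).mono inter_subset_right inter_subset_right
  · obtain ⟨a, ha⟩ := hWU S.1 (Finset.card_pos.1 (by rw [S.2]; exact Nat.succ_pos k))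
    exact hloc a _ (hV.inter (hWo S.1)) (inter_subset_right.trans ha)

include hloc hWo hWU hdisj in
/-- **`θ` is bijective over `V ∩ (W_0 ∪ ⋯ ∪ W_n)` for every open `V`** (induction on `n`, union step).
[cite: MilnorStasheff1974, §10 Thm. 10.4 (proof)] [cite: HusemollerFibreBundles1994, Ch. 17 §1 Thm. 1.1 (proof)] -/
theorem isLH_inter_exhaustion : ∀ (n : ℕ) {V : Set B}, IsOpen V → IsLH R d p c (V ∩ exhaustion W n)
  | 0, _, hV => isLH_inter_level R d p c hloc hWo hWU hdisj hV 0
  | n + 1, V, hV => by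
    change IsLH R d p c (V ∩ (exhaustion W n ∪ level W (n + 1)))
    rw [inter_union_distrib_left]
    refine isLH_union R d p c (hV.inter (isOpen_exhaustion hWo n)) (hV.inter (isOpen_level hWo (n + 1)))
      (isLH_inter_exhaustion n hV) (isLH_inter_level R d p c hloc hWo hWU hdisj hV (n + 1)) ?_
    rw [isLH_congr R d p c (show V ∩ exhaustion W n ∩ (V ∩ level W (n + 1)) = (V ∩ exhaustion W n) ∩ level W (n + 1) by
      ext b; simp only [mem_inter_iff]; tauto)]
    exact isLH_inter_level R d p c hloc hWo hWU hdisj (hV.inter (isOpen_exhaustion hWo n)) (n + 1)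

end Cover

/-- **The Leray–Hirsch theorem, local-to-global form** (Husemoller 17 §1 Thm. 1.1 with Rem. 1.2;
Hatcher Thm. 4D.1): over a paracompact Hausdorff base, if the comparison map
`(aⱼ) ↦ Σⱼ p^*aⱼ ⌣ cⱼ` is bijective over every open subset of every member of some open cover of
`B`, then `θ : Π_{d j ≤ k} Hᵏ⁻ᵈʲ(B; R) → Hᵏ(E; R)` is bijective for every `k`.
[cite: HusemollerFibreBundles1994, Ch. 17 §1 Thm. 1.1, Rem. 1.2] [cite: HatcherAT2002, §4.D Thm. 4D.1] -/
theorem bijective_of_cover [T2Space B] [ParacompactSpace B] {α : Type*} (U : α → Set B) (hUo : ∀ a, IsOpen (U a))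
    (hU : ⋃ a, U a = univ) (hloc : ∀ (a : α) (W : Set B), IsOpen W → W ⊆ U a → IsLH R d p c W) (k : ℕ) :
    Bijective (lhMap R d p c k) := by
  obtain ⟨W, hWo, hWU, hdisj, hcov⟩ := exists_nat_cover_by_disjoint_subordinate U hUo hU
  refine bijective_of_exhaustion R d p c (isOpen_exhaustion hWo) monotone_exhaustion (iUnion_exhaustion hcov)
    (fun n ↦ ?_) k
  rw [← isLH_congr R d p c (univ_inter (exhaustion W n))]
  exact isLH_inter_exhaustion R d p c hloc hWo hWU hdisj n isOpen_univ

/-- The same, read on `E → B` without subsets: `θ` for `p⁻¹univ → univ` versus `θ` for `p`.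
`IsLH univ` is equivalent to the bijectivity of `lhMap p c`. [folklore] -/
theorem isLH_univ_iff : IsLH R d p c univ ↔ ∀ k, Bijective (lhMap R d p c k) :=
  bijective_iff_of_homeomorph R d (resMap p univ) p
    ((Homeomorph.Set.univ X).symm.trans (Homeomorph.setCongr (preimage_univ (f := p)).symm)) (Homeomorph.Set.univ B).symm
    rfl _ _ fun j ↦ by
      have e : (subsetIncl (p ⁻¹' univ)).comp
          (((Homeomorph.Set.univ X).symm.trans (Homeomorph.setCongr (preimage_univ (f := p)).symm) : X ≃ₜ ↥(p ⁻¹' univ)) :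
            C(X, ↥(p ⁻¹' univ))) = ContinuousMap.id X := by
        ext; rfl
      rw [← ModuleCat.comp_apply, ← singularCohomology.map_comp, e, singularCohomology.map_id]
      rfl

end LerayHirsch

end Literature.AlgebraicTopology.SingularHomology
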